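import Summits.ResolutionOfSingularities.ResolutionOfSingularities.Theorems.FrobeniusClosingPatchingRelPerfectK52PiltantHypotheses
import Summits.ResolutionOfSingularities.ResolutionOfSingularities.Theorems.PatchingRelPerfect.Negative.LoadBearing
import Literature.Barriers.ResolutionOfSingularities.DimensionFourFrontier
import Literature.AlgebraicGeometry.Resolution.ProperModelsPatchingOfResolution
import Literature.AlgebraicGeometry.Resolution.ZariskiPatchingProperModelsWeakLU
import HarnessLib.Audit
import HarnessLib

/-!
# Crux `PatchingRelPerfect` (stmt-ResolutionOfSingularities-16161) — kill test K5.2, conformance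
# addendum to SIZED-ASK-L v0.2 §K2: Piltant's patching INPUT as one structure over the tree's
# LU vocabulary, the two requested implications, and the «summit in costume» clause

[OURS · L1 W5.2 · K5.2 ledger, gen-2 addendum] A helper for the crux chain on `PatchingRelPerfect`;
nothing here is a statement of Hironaka's manuscript and no verdict on any paper is implied. AI
review is weaker than expert review. Companion of
`Theorems/FrobeniusClosingPatchingRelPerfectK52PiltantHypotheses.lean` (the K5.2 typed ledger,
hypothesis by hypothesis); the reading is in
`run/shared/lean/pub/res-hironaka/L/res-L1-k52/KILL-TEST-K5.2.md` (§6 for this addendum).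

SIZED-ASK-L v0.2 §K2 K5.2 asks, verbatim: «one file … stating Piltant's patching input as a
`structure` / `Prop` over the tree's LU vocabulary and the two implications «Piltant-input ∧
dim ≤ 3 → PatchingRelPerfect-instance» (expected from `cossartPiltant2019LU3_iff`) and
«PatchingRelPerfect-body → ∃ the two models» (does the body even NAME them?)», and scores a third
outcome «DEAD (for the slot) = the body as typed is implied by / equivalent to resolution in
dim ≥ 4 with no separating content (W5.2 would be the summit in costume)». This file is the
kernel-checked part of the answer:

* `K52.PiltantInput p n` — Piltant's (2013) patching input for the usual regularity property
  `P = P_reg`, function fields of transcendence degree `n` over PERFECT ground fields of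
  characteristic `p`, as ONE structure with the dimension `n` free: Axiom 4 (principalization,
  `K52.PrincipalizationDim n`), Axiom 5 (local uniformization, the barrier's
  `LocalUniformizationUpToDim k n`) and the lower-dimensional resolution input that feeds
  Cossart–Piltant 2008 Props. 4.8/4.9 (embedded resolution of surfaces when `n = 3`; here, as in
  the barrier's `ZariskiPatchingUpToDim n`, weak resolution up to dimension `n − 1`). Axioms 1, 2,
  3, 6 are not fields: for `P = P_reg` they are printed, dimension-free statements about the
  regular locus and about CURVES (Piltant 2013, Ex. 2.3, Prop. 3.5 with `μ = 1`), internal to one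
  proof, and the tree has no vocabulary for "stably `P`-permissible" (Def. 2.2) — see the K5.2
  ledger's module docstring.
* FIRST IMPLICATION `piltantInput_three_instance`: `PiltantInput p 3` together with the PRINTED
  patching theorem in dimension `3` (`CossartPiltant2019Patching` = `ZariskiPatchingUpToDim 3`,
  `zariskiPatchingUpToDim_three_iff`; Cossart–Piltant 2019 Prop. 4.6, whose proof is Piltant's
  Prop. 5.1 + Cor. 5.7) gives the dimension-`≤ 3` instance of the crux's conclusion over every
  perfect field of characteristic `p`. (`res_three_of_cossartPiltant2019`: that instance is in
  fact a printed theorem outright, `CossartPiltant2019`, with no LU hypothesis at all.)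
* SECOND IMPLICATION, «does the body NAME the two models?» — NO: `patchingRelPerfect_iff` unfolds
  the crux to `∀ p prime, LUrelPerfect_p → ResPerfect_p` (relative LU over perfect fields ⇒
  resolution over perfect fields); no model, proper or projective, is quantified over. The two
  models are PROOF-INTERNAL: they are the `M₁ M₂ : ProperModel k K` of the tree's
  `ProperModel.TwoModelPatching p` (Piltant 2013 Prop. 5.1, `P = P_reg`) through which the
  tree's reduction `resolutionOverUpToDim_of_twoModelPatching_of_relLU` /
  `Theorems.patchingRelPerfect_of_twoModelPatchingPerfect` derives the crux — DEFINED objects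
  (`Literature/AlgebraicGeometry/Resolution/ProperModels.lean`). `twoModelPatchingPerfect_of_resPerfect`
  (fibrewise, adapted from the crux workfile `Cruxes/PatchingRelPerfect/Lines/birth.lean`): the
  two-model statement over perfect fields is itself a consequence of the crux's conclusion, so
  «∃ the two models (patched)» follows from the body exactly under its antecedent.
* «SUMMIT IN COSTUME?» — `resPerfect_iff_lurelPerfect_and_patchingRelPerfect`: resolution over
  all perfect fields of positive characteristic is EQUIVALENT to (relative LU over all perfect
  fields of positive characteristic) ∧ `PatchingRelPerfect` — the crux is exactly the complement
  of local uniformization in the perfect-field slice of the summit (Zariski's decomposition is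
  lossless: `Negative.lurelPerfect_of_resPerfect`, valuative criterion). Its SEPARATING CONTENT
  from resolution is therefore precisely the antecedent `LUrelPerfect_p`, which is printed as
  OPEN in transcendence degree `≥ 4` (Cossart–Piltant 2019 §1: "Its local variant for valuations
  … remains equally unsolved"; the tree's `Temkin2013` / `KnafKuhlmann2009_holds` give LU only
  after a purely inseparable / finite extension of the function field) and is itself NECESSARY
  for resolution. So the §K2 DEAD clause («equivalent to resolution with no separating content»)
  does not fire; what is true, and was the verdict's HONEST CAVEAT, is the conditional form
  `Negative.patchingRelPerfect_iff_resPerfect_of_lurelPerfect`: GIVEN LU, the crux IS resolution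
  over perfect fields (the barrier's `scope_caveats` (e) for `ZariskiPatchingUpToDim 4`).
* `piltantInput_ax5_resBelow_of_resPerfect`: two of the three fields of Piltant's input
  (Axiom 5 and the lower-dimensional resolution) are consequences of the crux's own conclusion
  (`LocalUniformizationUpToDim.of_resolution`); Axiom 4 (principalization along regular centres)
  is not derived from weak resolution anywhere in the tree. `piltantInput_four_res_of_atomDimFour`:
  in dimension `4` the line of record consumes only `ax5` and `resBelow` of the input, plus the
  registered open core `AtomDimFour p` and the three printed named facts, to reach resolution up
  to dimension `4` over every perfect field of characteristic `p` — Axiom 4 in dimension `4` is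
  bypassed (K5.2 ledger, row H4).

## References

* O. Piltant, *An axiomatic version of Zariski's patching theorem*, RACSAM 107 (2013) 91–121
  (HAL hal-00612635): §2 Axioms 1–6, Thm. 2.4, §5 Prop. 5.1, Cor. 5.7; p. 2 ("never been
  extended to dimensions higher than three"), p. 3 ("open in dimension four or more"). [Piltant2013]
* V. Cossart, O. Piltant, J. Algebra 320 (2008) 1051–1082, §4 Props. 4.7–4.9. [CossartPiltant2008]
* V. Cossart, O. Piltant, J. Algebra 529 (2019) (arXiv:1412.0868), §1 and Prop. 4.6 (v1 4.4). [CossartPiltant2019]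
* S. D. Cutkosky, H. Mourtada, *Defect and local uniformization* (arXiv:1711.02726), §1. [CutkoskyMourtada2019]
-/

-- `Summit.<Summit>.<Sub>.Theorems` with `Sub = Summit` (single-conjunct summit, D-0017)
set_option linter.dupNamespace false

noncomputable section

open CategoryTheory AlgebraicGeometry Literature.AlgebraicGeometry.Resolution
open Literature.Barriers.ResolutionOfSingularities
open Summit.ResolutionOfSingularities.ResolutionOfSingularities.Theses

namespace Summit.ResolutionOfSingularities.ResolutionOfSingularities.Theorems

namespace K52

/-! ## Piltant's patching input for `P = P_reg`, dimension `n`, perfect ground fields of characteristic `p` -/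

/-- **Piltant's patching input, `P = P_reg`, transcendence degree `n`, perfect ground fields of
characteristic `p`** [OURS · L1 W5.2 · K5.2 ledger]: the three load-bearing hypotheses of
Piltant's (2013) axiomatic patching theorem (Thm. 2.4) and of Cossart–Piltant 2008 §4
(Props. 4.8/4.9), typed over the tree's vocabulary with the dimension `n` FREE — Axiom 4
(principalization in dimension `n`), Axiom 5 (local uniformization up to dimension `n`) and the
lower-dimensional resolution input (embedded resolution of surfaces for `n = 3`; here weak
resolution up to dimension `n − 1`, as in the barrier's `ZariskiPatchingUpToDim n`). Axioms 1,
2, 3, 6 are printed dimension-free facts about `Reg` and about curves for `P = P_reg` and are not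
fields. A bundle of HYPOTHESES; nothing is asserted.
[cite: Piltant2013, §2 Axioms 4–5 and Thm. 2.4; CossartPiltant2008, Props. 4.8–4.9] -/
@[conjecture] structure PiltantInput (p n : ℕ) : Prop where
  /-- Axiom 4: principalization of ideals on regular excellent `n`-dimensional schemes by
  Cossart–Piltant sequences of blowing ups along regular centres (`PrincipalizationDim n`;
  at `n = 3` the printed `CossartPiltant2019Principalization`). -/
  ax4 : PrincipalizationDim n
  /-- Axiom 5: local uniformization up to dimension `n` over every perfect field of
  characteristic `p` (the barrier's `LocalUniformizationUpToDim`). -/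
  ax5 : ∀ (k : Type) [Field k] [CharP k p] [PerfectField k], LocalUniformizationUpToDim.{0} k n
  /-- The lower-dimensional input: weak resolution up to dimension `n − 1` over every perfect
  field of characteristic `p`. -/
  resBelow : ∀ (k : Type) [Field k] [CharP k p] [PerfectField k],
    ResolutionOverUpToDim.{0} k (n - 1)

/-! ## First implication: input ∧ dim ≤ 3 → the dimension-`≤ 3` instance -/

/-- **«Piltant-input ∧ dim ≤ 3 → PatchingRelPerfect-instance»**: Piltant's input in dimension
`3` over perfect fields of characteristic `p`, together with the PRINTED dimension-`3` patching
theorem (`CossartPiltant2019Patching`, which is `ZariskiPatchingUpToDim 3` verbatim —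
Cossart–Piltant 2019 Prop. 4.6, proved by Piltant's Prop. 5.1 and Cor. 5.7), gives weak
resolution up to dimension `3` over every perfect field of characteristic `p`. Only `ax5` and
`resBelow` are consumed; Axiom 4 is consumed INSIDE the printed proof (via Prop. 4.4), not by
this composition. CONDITIONAL on the named fact.
[cite: CossartPiltant2019, Prop. 4.6 (arXiv v1: Prop. 4.4); Piltant2013, Prop. 5.1 and Cor. 5.7] -/
theorem piltantInput_three_instance (hZ3 : CossartPiltant2019Patching.{0}) {p : ℕ}
    (h : PiltantInput p 3) :
    ∀ (k : Type) [Field k] [CharP k p] [PerfectField k], ResolutionOverUpToDim.{0} k 3 :=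
  fun k _ _ _ => (zariskiPatchingUpToDim_three_iff.mpr hZ3) k (h.resBelow k) (h.ax5 k)

/-- The same instance is a printed theorem OUTRIGHT: Cossart–Piltant 2019 Thm. 1.1 (the tree's
named fact `CossartPiltant2019`) gives weak resolution up to dimension `3` over EVERY field, so
the dimension-`≤ 3` slice of the crux `PatchingRelPerfect` holds with its LU antecedent unused.
CONDITIONAL on the named fact. [cite: CossartPiltant2019, Thm. 1.1] -/
theorem res_three_of_cossartPiltant2019 (h3 : CossartPiltant2019.{0}) (p : ℕ) :
    ∀ (k : Type) [Field k] [CharP k p] [PerfectField k], ResolutionOverUpToDim.{0} k 3 :=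
  fun k _ _ _ => cossartPiltant2019_iff.mp h3 k

/-! ## Second implication: the body names NO model; where the two models enter -/

/-- **The body of the crux names no model**: `PatchingRelPerfect` is, by `Iff.rfl`,
`∀ p prime, LUrelPerfect_p → ResPerfect_p` — relative local uniformization over perfect fields
of characteristic `p` (valuation rings and finitely generated subalgebras of a finitely generated
`K/k`) implies resolution of every reduced separated scheme of finite type over every perfect
field of characteristic `p`. No proper or projective model is quantified over: the «two models»
of the kill test are the `M₁ M₂ : ProperModel k K` of the PROOF-INTERNAL statement
`ProperModel.TwoModelPatching p` (Piltant 2013 Prop. 5.1, `P = P_reg`), which enters only through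
the tree's reduction (`resolutionOverUpToDim_of_twoModelPatching_of_relLU`,
`Theorems.patchingRelPerfect_of_twoModelPatchingPerfect`). [folklore] -/
theorem patchingRelPerfect_iff :
    FrobeniusClosing.PatchingRelPerfect ↔ ∀ p : ℕ, p.Prime →
      (∀ (k K : Type) [Field k] [CharP k p] [PerfectField k] [Field K] [Algebra k K],
        (⊤ : IntermediateField k K).FG →
        ∀ O : ValuationSubring K, (∀ c : k, algebraMap k K c ∈ O) → ∀ R : Subalgebra k K, R.FG →
          R.toSubring ≤ O.toSubring → ∃ (A : Subalgebra k K) (h : A.toSubring ≤ O.toSubring),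
            R ≤ A ∧ A.FG ∧ IsFractionRing A K ∧ IsRegularLocalRing (Localization.AtPrime
              (Ideal.comap (Subring.inclusion h) (IsLocalRing.maximalIdeal O)))) →
      ∀ (k : Type) [Field k] [CharP k p] [PerfectField k] (X : Scheme.{0}) (f : X ⟶ Spec (.of k)),
        IsSeparated f → LocallyOfFiniteType f → QuasiCompact f → IsReduced X →
          Scheme.HasResolution X :=
  Iff.rfl

/-- **The two-model statement over perfect fields follows from the crux's CONCLUSION**
(fibrewise, every transcendence degree): resolution of reduced separated schemes of finite type
over a perfect field `k` of characteristic `p` gives, for every `K/k` essentially of finite type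
and all proper models `M₁, M₂` of `K/k`, a proper model `N → Mᵢ` regular over `Reg Mᵢ` — resolve
the join `M₁ ⋈ M₂`; a regular model is `RegLe` over everything it dominates. So under the crux's
antecedent the body yields «the two models, patched»; and two-model patching over perfect fields
is NO WEAKER a target than the crux's conclusion. [folklore] -/
-- adapted from Cruxes/PatchingRelPerfect/Lines/birth.lean (`twoModelPatchingPerfect_of_resPerfect`)
theorem twoModelPatchingPerfect_of_resPerfect {p : ℕ}
    (h : ∀ (k : Type) [Field k] [CharP k p] [PerfectField k] (X : Scheme.{0}) (f : X ⟶ Spec (.of k)),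
      IsSeparated f → LocallyOfFiniteType f → QuasiCompact f → IsReduced X → Scheme.HasResolution X) :
    ∀ (k : Type) [Field k] [CharP k p] [PerfectField k] (K : Type) [Field K] [Algebra k K]
      [Algebra.EssFiniteType k K], ∀ M₁ M₂ : ProperModel k K,
        ∃ (N : ProperModel k K) (φ₁ : N.Hom M₁) (φ₂ : N.Hom M₂), φ₁.RegLe ∧ φ₂.RegLe := by
  intro k _ _ _ K _ _ _ M₁ M₂
  obtain ⟨N, φ, hN⟩ := (ProperModel.join M₁ M₂).exists_hom_isRegular_of_hasResolution
    (h k (ProperModel.join M₁ M₂).X (ProperModel.join M₁ M₂).π inferInstance inferInstance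
      inferInstance inferInstance)
  exact ⟨N, φ.comp (ProperModel.joinFst M₁ M₂), φ.comp (ProperModel.joinSnd M₁ M₂),
    fun y _ => hN y, fun y _ => hN y⟩

/-! ## «Summit in costume?» — the crux is exactly the complement of LU in the perfect-field slice -/

/-- **Zariski's decomposition of the perfect-field slice of the summit is lossless**: resolution
of reduced separated schemes of finite type over all perfect fields of every positive
characteristic holds IF AND ONLY IF relative local uniformization over all perfect fields of
every positive characteristic holds AND the crux `PatchingRelPerfect` holds. (`→`: LU is
NECESSARY for resolution, `Negative.lurelPerfect_of_resPerfect`, valuative criterion; the crux is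
implied by its own conclusion. `←`: modus ponens.) Hence the crux's separating content from the
summit slice is PRECISELY its antecedent — local uniformization over perfect fields, printed as
open in transcendence degree `≥ 4` — and, given that antecedent, the crux IS resolution over
perfect fields (`Negative.patchingRelPerfect_iff_resPerfect_of_lurelPerfect`). [folklore] -/
theorem resPerfect_iff_lurelPerfect_and_patchingRelPerfect :
    (∀ p : ℕ, p.Prime →
      ∀ (k : Type) [Field k] [CharP k p] [PerfectField k] (X : Scheme.{0}) (f : X ⟶ Spec (.of k)),
        IsSeparated f → LocallyOfFiniteType f → QuasiCompact f → IsReduced X →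
          Scheme.HasResolution X) ↔
    (∀ p : ℕ, p.Prime →
      ∀ (k K : Type) [Field k] [CharP k p] [PerfectField k] [Field K] [Algebra k K],
        (⊤ : IntermediateField k K).FG →
        ∀ O : ValuationSubring K, (∀ c : k, algebraMap k K c ∈ O) → ∀ R : Subalgebra k K, R.FG →
          R.toSubring ≤ O.toSubring → ∃ (A : Subalgebra k K) (h : A.toSubring ≤ O.toSubring),
            R ≤ A ∧ A.FG ∧ IsFractionRing A K ∧ IsRegularLocalRing (Localization.AtPrime
              (Ideal.comap (Subring.inclusion h) (IsLocalRing.maximalIdeal O)))) ∧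
    FrobeniusClosing.PatchingRelPerfect :=
  ⟨fun h => ⟨fun p hp => PatchingRelPerfect.Negative.lurelPerfect_of_resPerfect p (h p hp),
      fun p hp _ => h p hp⟩,
    fun h p hp => h.2 p hp (h.1 p hp)⟩

/-! ## Which fields of Piltant's input the goal itself forces, and what dimension `4` consumes -/

/-- **Axiom 5 and the lower-dimensional input are consequences of the crux's conclusion**
(every `n`): resolution over perfect fields of characteristic `p` gives `LocalUniformizationUpToDim k n`
(valuative criterion, `LocalUniformizationUpToDim.of_resolution`) and `ResolutionOverUpToDim k (n − 1)`
over every perfect `k` of characteristic `p`. Axiom 4 (principalization along regular centres)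
is the one field not derived from weak resolution anywhere in the tree. [folklore] -/
theorem piltantInput_ax5_resBelow_of_resPerfect {p : ℕ} (n : ℕ)
    (h : ∀ (k : Type) [Field k] [CharP k p] [PerfectField k] (X : Scheme.{0}) (f : X ⟶ Spec (.of k)),
      IsSeparated f → LocallyOfFiniteType f → QuasiCompact f → IsReduced X → Scheme.HasResolution X) :
    (∀ (k : Type) [Field k] [CharP k p] [PerfectField k], LocalUniformizationUpToDim.{0} k n) ∧
      ∀ (k : Type) [Field k] [CharP k p] [PerfectField k], ResolutionOverUpToDim.{0} k (n - 1) := by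
  have hres : ∀ (k : Type) [Field k] [CharP k p] [PerfectField k] (d : ℕ),
      ResolutionOverUpToDim.{0} k d :=
    fun k _ _ _ d X f hs hl hq hr _ => h k X f hs hl hq hr
  exact ⟨fun k _ _ _ => LocalUniformizationUpToDim.of_resolution (hres k n),
    fun k _ _ _ => hres k (n - 1)⟩

/-- **What the line of record consumes in dimension `4`**: from Piltant's input in dimension `4`
only `ax5` (`LU₄` over perfect fields) and `resBelow` (resolution up to dimension `3`) are used;
with the three printed named facts and the registered open core `AtomDimFour p` they give weak
resolution up to dimension `4` over every perfect field of characteristic `p`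
(`zariskiPatching_four_perfect_of_namedFacts_of_atomDimFour`). Axiom 4 in dimension `4`
(`ax4 : PrincipalizationDim 4`, no printed proof) is BYPASSED by this route. CONDITIONAL.
[cite: CossartPiltant2019, Thm. 1.1 and Prop. 4.4; CossartJannsenSaito2020, Thm. 1.2; Piltant2013, Prop. 5.1] -/
theorem piltantInput_four_res_of_atomDimFour (p : ℕ) (hp : p.Prime)
    (hG : CossartPiltant2019General.{0}) (hP : CossartPiltant2019Principalization.{0})
    (hS : CossartJannsenSaito2020Sequence.{0}) (hT4 : AtomDimFour p) (h : PiltantInput p 4) :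
    ∀ (k : Type) [Field k] [CharP k p] [PerfectField k], ResolutionOverUpToDim.{0} k 4 :=
  fun k _ _ _ =>
    zariskiPatching_four_perfect_of_namedFacts_of_atomDimFour p hp hG hP hS hT4 k
      (h.resBelow k) (h.ax5 k)

end K52

end Summit.ResolutionOfSingularities.ResolutionOfSingularities.Theorems

end
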